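import Mathlib
import HarnessLib
import Summits.Parity.GeneralizedHardyLittlewood.Theorems.DilatedChowla.Negative.DilatedChowlaMirrorOnePointDefs
import Literature.Barriers.Parity.SiegelZeroDichotomyChowlaTools
import Literature.NumberTheory.LFunctions.SiegelZeroExceptionalPrimes

/-!
# `DilatedChowla` (stmt-Parity-13319): the unit-class law gives a one-point lower bound

Line `Sketch` (card `siegel-mirror`), stub E (`coherentBias_one_of_onePointExc`), first half: the
DICTIONARY between the one-point progression sums `P 1 k M = Σ_{m ∈ (M,2M]} λ(mk+1)` of the crux and
the unit-class sums `T k y = Σ_{u ≤ y, u ≡ 1 (k)} λ(u)` of the law `OnePointExcLaw`, and the resulting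
lower bound for `P 1 k M` in the presence of a Siegel zero.

* `bias_T_natCast`, `bias_P_one_eq` : `P 1 k M = T k (2kM+1) − T k (kM+1)`.
* `bias_transfer` : a Siegel zero `L(1 − 1/(η log q), χ) = 0` of a primitive quadratic `χ mod q`
  is a real zero of `L(s, ψ)` for the induced real character `ψ = χ ∘ (ZMod k → ZMod q)`, `q ∣ k`
  (`LFunction_changeLevel`).
* `bias_rpow_chord` (Bernoulli), `bias_diff_lower`, `bias_undamped`, `bias_quarter` : the
  elementary real analysis turning the two-sided law at `y₁ = kM+1`, `y₂ = 2kM+1` into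
  `P 1 k M ≥ R·M/4` once `y₂^{β−1} ≥ e^{-1}` (undamped: `log y₂ ≤ η log q`) and `k² ≥ 50(1 + 1/R)`.
* `bias_P_lower` : for `q ∣ k`, `q ≤ k ≤ q²`, `M ≥ exp(C₁(1 + 2 log q)²)` and the numerical
  side conditions, `P 1 k M ≥ M/(4 C₂ (1 + 2 log q)⁵)`.

Elementary; no cited facts (the law `OnePointExcLaw` is a hypothesis).
-/

noncomputable section

namespace Summit.Parity.GeneralizedHardyLittlewood.Theorems.DilatedChowla.Negative

open Summit.Parity.GeneralizedHardyLittlewood.Theorems.DilatedTableChowla.Negative (L L_natCast)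
open Literature.Barriers.Parity (IsSiegelZero)
open Finset

/-! ## §1 The dictionary `P ↔ T` -/

/-- For `k ≥ 1` the unit class up to `kN+1` is `{mk+1 : m ≤ N}`:
`T k (kN+1) = Σ_{m ≤ N} λ(mk+1)`. -/
theorem bias_T_natCast (k N : ℕ) (hk : 1 ≤ k) :
    T k ((k * N + 1 : ℕ) : ℝ) =
      ∑ m ∈ range (N + 1), (ArithmeticFunction.liouville (m * k + 1) : ℝ) := by
  unfold T
  rw [Nat.floor_natCast]
  symm
  refine sum_nbij' (fun m => m * k + 1) (fun u => (u - 1) / k) ?_ ?_ ?_ ?_ ?_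
  · intro m hm
    rw [mem_range] at hm
    rw [mem_filter, mem_Icc]
    refine ⟨⟨by omega, ?_⟩, ?_⟩
    · have : m * k ≤ N * k := Nat.mul_le_mul_right k (by omega)
      linarith [Nat.mul_comm N k]
    · unfold Nat.ModEq
      simp
  · intro u hu
    rw [mem_filter, mem_Icc] at hu
    obtain ⟨⟨hu1, huN⟩, hmod⟩ := hu
    obtain ⟨t, ht⟩ := (Nat.modEq_iff_dvd' hu1).1 hmod.symm
    rw [mem_range]
    have hdiv : (u - 1) / k = t := by rw [ht, Nat.mul_div_cancel_left _ (by omega)]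
    rw [hdiv]
    have h1 : k * t ≤ k * N := by omega
    have := Nat.le_of_mul_le_mul_left h1 (by omega)
    omega
  · intro m _
    show (m * k + 1 - 1) / k = m
    rw [Nat.add_sub_cancel, Nat.mul_div_cancel _ (by omega)]
  · intro u hu
    rw [mem_filter, mem_Icc] at hu
    obtain ⟨⟨hu1, _⟩, hmod⟩ := hu
    obtain ⟨t, ht⟩ := (Nat.modEq_iff_dvd' hu1).1 hmod.symm
    show (u - 1) / k * k + 1 = u
    rw [ht, Nat.mul_div_cancel_left _ (by omega)]
    rw [Nat.mul_comm] at ht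
    omega
  · intro m _
    rfl

/-- **The dictionary.** For `k ≥ 1`: `P 1 k M = T k (2kM+1) − T k (kM+1)` (the `M` terms
`mk+1`, `m ∈ (M,2M]`, are exactly the members of the unit class in `(kM+1, 2kM+1]`). -/
theorem bias_P_one_eq (k M : ℕ) (hk : 1 ≤ k) :
    P 1 k M = T k (2 * (k : ℝ) * M + 1) - T k ((k : ℝ) * M + 1) := by
  have e2 : (2 * (k : ℝ) * M + 1) = ((k * (2 * M) + 1 : ℕ) : ℝ) := by push_cast; ring
  have e1 : ((k : ℝ) * M + 1) = ((k * M + 1 : ℕ) : ℝ) := by push_cast; ring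
  rw [e2, e1, bias_T_natCast k (2 * M) hk, bias_T_natCast k M hk, eq_sub_iff_add_eq, P,
    range_eq_Ico, range_eq_Ico]
  have h1 : ∑ m ∈ Ioc M (2 * M), L ((m : ℤ) * k + 1) =
      ∑ m ∈ Ico (M + 1) (2 * M + 1), (ArithmeticFunction.liouville (m * k + 1) : ℝ) := by
    rw [Finset.Ico_add_one_add_one_eq_Ioc]
    refine sum_congr rfl fun m _ => ?_
    rw [show (m : ℤ) * k + 1 = ((m * k + 1 : ℕ) : ℤ) by push_cast; ring, L_natCast]
  rw [h1, add_comm]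
  exact sum_Ico_consecutive _ (by omega) (by omega)

/-! ## §2 From a Siegel zero to the hypotheses of the law -/

/-- A Siegel zero of a primitive quadratic `χ mod q` is a real zero of `L(s, ψ)` for the induced
character `ψ mod k`, `q ∣ k`, which is real and non-principal. -/
theorem bias_transfer {q k : ℕ} [NeZero q] [NeZero k] (hdvd : q ∣ k)
    {χ : DirichletCharacter ℂ q} {η : ℝ} (hz : IsSiegelZero χ η) :
    DirichletCharacter.changeLevel hdvd χ ≠ 1 ∧ (DirichletCharacter.changeLevel hdvd χ) ^ 2 = 1 ∧
      (DirichletCharacter.changeLevel hdvd χ).LFunction ((1 - 1 / (η * Real.log q) : ℝ) : ℂ) = 0 := by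
  have h1 : χ ≠ 1 := hz.ne_one
  refine ⟨fun h => h1 ((DirichletCharacter.changeLevel_eq_one_iff hdvd).mp h), ?_, ?_⟩
  · rw [← map_pow, hz.2.1.sq_eq_one, map_one]
  · rw [DirichletCharacter.LFunction_changeLevel hdvd χ (Or.inl h1), hz.2.2.2, zero_mul]

/-! ## §3 Elementary real analysis -/

/-- Chord above the right-end tangent for the concave `t ↦ t^β`, `0 ≤ β ≤ 1` (Bernoulli):
`β · y₂^{β−1} · (y₂ − y₁) ≤ y₂^β − y₁^β` for `0 ≤ y₁`, `0 < y₂` (used for `y₁ ≤ y₂`). -/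
theorem bias_rpow_chord {y₁ y₂ β : ℝ} (h₁ : 0 ≤ y₁) (h₂ : 0 < y₂)
    (hβ0 : 0 ≤ β) (hβ1 : β ≤ 1) :
    β * y₂ ^ (β - 1) * (y₂ - y₁) ≤ y₂ ^ β - y₁ ^ β := by
  have hs : -1 ≤ y₁ / y₂ - 1 := by linarith [div_nonneg h₁ h₂.le]
  have hy2β : 0 < y₂ ^ β := Real.rpow_pos_of_pos h₂ β
  have hB : (y₁ / y₂) ^ β ≤ 1 + β * (y₁ / y₂ - 1) := by
    have := rpow_one_add_le_one_add_mul_self hs hβ0 hβ1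
    rwa [add_sub_cancel] at this
  rw [Real.div_rpow h₁ h₂.le, div_le_iff₀ hy2β] at hB
  rw [Real.rpow_sub_one h₂.ne']
  have key : β * (y₂ ^ β / y₂) * (y₂ - y₁) = y₂ ^ β - (1 + β * (y₁ / y₂ - 1)) * y₂ ^ β := by
    field_simp
    ring
  rw [key]
  linarith

/-- The dictionary inequality: the two-sided law at `y₁ = kM+1` and `y₂ = 2kM+1` gives
`T₂ − T₁ ≥ R · y₂^{β−1} · M − 5(R+1)M/k²` (main terms by `bias_rpow_chord` and `φ ≤ k`; error
terms by `y₁ + y₂ = 3kM + 2 ≤ 5kM`). -/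
theorem bias_diff_lower {R β φ k M T₁ T₂ : ℝ} (hR : 0 ≤ R) (hβ0 : 0 < β) (hβ1 : β ≤ 1)
    (hφ0 : 0 < φ) (hφk : φ ≤ k) (hk : 1 ≤ k) (hM : 1 ≤ M)
    (h1 : |T₁ - R * (k * M + 1) ^ β / (φ * β)| ≤ (R + 1) * (k * M + 1) / k ^ 3)
    (h2 : |T₂ - R * (2 * k * M + 1) ^ β / (φ * β)| ≤ (R + 1) * (2 * k * M + 1) / k ^ 3) :
    R * (2 * k * M + 1) ^ (β - 1) * M - 5 * (R + 1) * M / k ^ 2 ≤ T₂ - T₁ := by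
  have hk0 : 0 < k := by linarith
  have hM0 : 0 ≤ M := by linarith
  have hkM : 1 ≤ k * M := by nlinarith
  set y₁ := k * M + 1 with hy₁def
  set y₂ := 2 * k * M + 1 with hy₂def
  have hy₁ : 0 < y₁ := by positivity
  have hy₂ : 0 < y₂ := by positivity
  have hdiff : y₂ - y₁ = k * M := by simp only [hy₁def, hy₂def]; ring
  have hpow : 0 < y₂ ^ (β - 1) := Real.rpow_pos_of_pos hy₂ _
  rw [abs_le] at h1 h2
  have hchord := bias_rpow_chord hy₁.le hy₂ hβ0.le hβ1
  -- main terms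
  have hmain : R * y₂ ^ (β - 1) * M ≤ R * y₂ ^ β / (φ * β) - R * y₁ ^ β / (φ * β) := by
    rw [← sub_div, ← mul_sub, le_div_iff₀ (by positivity)]
    calc R * y₂ ^ (β - 1) * M * (φ * β)
        ≤ R * y₂ ^ (β - 1) * M * (k * β) := by
          apply mul_le_mul_of_nonneg_left _ (by positivity)
          exact mul_le_mul_of_nonneg_right hφk hβ0.le
      _ = R * (β * y₂ ^ (β - 1) * (y₂ - y₁)) := by rw [hdiff]; ring
      _ ≤ R * (y₂ ^ β - y₁ ^ β) := mul_le_mul_of_nonneg_left hchord hR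
  -- error terms
  have herr : (R + 1) * y₁ / k ^ 3 + (R + 1) * y₂ / k ^ 3 ≤ 5 * (R + 1) * M / k ^ 2 := by
    have hk3 : 0 < k ^ 3 := by positivity
    calc (R + 1) * y₁ / k ^ 3 + (R + 1) * y₂ / k ^ 3
        = (R + 1) * (3 * (k * M) + 2) / k ^ 3 := by simp only [hy₁def, hy₂def]; ring
      _ ≤ (R + 1) * (5 * (k * M)) / k ^ 3 :=
          div_le_div_of_nonneg_right (mul_le_mul_of_nonneg_left (by linarith) (by linarith))
            hk3.le
      _ = 5 * (R + 1) * M / k ^ 2 := by field_simp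
  linarith [h1.2, h2.1, hmain, herr]

/-- The undamped factor: `y^{β−1} ≥ e^{−1}` as soon as `(1 − β) log y ≤ 1`. -/
theorem bias_undamped {y β : ℝ} (hy : 0 < y) (h : (1 - β) * Real.log y ≤ 1) :
    Real.exp (-1) ≤ y ^ (β - 1) := by
  rw [Real.rpow_def_of_pos hy, Real.exp_le_exp]
  have : Real.log y * (β - 1) = -((1 - β) * Real.log y) := by ring
  rw [this]
  linarith

/-- Numerics: `e^{−1} ≥ 7/20`. -/
theorem bias_exp_neg_one : (7 : ℝ) / 20 ≤ Real.exp (-1) := by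
  have h := Real.exp_one_lt_d9
  have hpos := Real.exp_pos 1
  calc (7 : ℝ) / 20 ≤ 1 / 2.7182818286 := by norm_num
    _ ≤ 1 / Real.exp 1 := one_div_le_one_div_of_le hpos h.le
    _ = Real.exp (-1) := by rw [Real.exp_neg, one_div]

/-- From `R · D · M − 5(R+1)M/k²` to `R·M/4` when `D ≥ e^{−1}` and `k² ≥ 50 (1 + 1/R)`. -/
theorem bias_quarter {R k M D : ℝ} (hR : 0 ≤ R) (hM : 0 ≤ M) (hk : 0 < k)
    (hD : Real.exp (-1) ≤ D) (hRk : 50 * (R + 1) ≤ R * k ^ 2) :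
    R * M / 4 ≤ R * D * M - 5 * (R + 1) * M / k ^ 2 := by
  have h1 : 7 / 20 ≤ D := le_trans bias_exp_neg_one hD
  have h2 : 5 * (R + 1) * M / k ^ 2 ≤ R * M / 10 := by
    rw [div_le_div_iff₀ (by positivity) (by norm_num)]
    nlinarith [mul_le_mul_of_nonneg_right hRk hM]
  nlinarith [mul_le_mul_of_nonneg_left h1 (mul_nonneg hR hM)]

/-! ## §4 The one-point lower bound from the unit-class law -/

/-- **One-point lower bound.** Let `OnePointExcLaw c₁ C₁ C₂` hold, let `χ mod q` carry a Siegel zero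
of quality `η` with `c₁ η > 4`, let `q ∣ k`, `q ≤ k ≤ q²`, `M ≥ exp(C₁ (1 + 2 log q)²)`, and assume
the undamping `log(2q²M + 1) ≤ η log q` and the size condition `50 (1 + C₂ (1 + 2 log q)⁵) ≤ q²`.
Then `P 1 k M ≥ M / (4 C₂ (1 + 2 log q)⁵)`. -/
theorem bias_P_lower {c₁ C₁ C₂ : ℝ} (hC₁ : 0 < C₁) (hC₂ : 0 < C₂)
    (hlaw : OnePointExcLaw c₁ C₁ C₂) {q k : ℕ} [NeZero q] [NeZero k] (hdvd : q ∣ k)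
    {χ : DirichletCharacter ℂ q} {η : ℝ} (hz : IsSiegelZero χ η) (hqk : q ≤ k) (hkq : k ≤ q * q)
    {M : ℕ} (hM : Real.exp (C₁ * (1 + 2 * Real.log q) ^ 2) ≤ M) (hR4 : 4 < c₁ * η)
    (hR5 : Real.log (2 * (q : ℝ) ^ 2 * M + 1) ≤ η * Real.log q)
    (hR6 : 50 * (1 + C₂ * (1 + 2 * Real.log q) ^ 5) ≤ (q : ℝ) ^ 2) :
    (M : ℝ) / (4 * C₂ * (1 + 2 * Real.log q) ^ 5) ≤ P 1 k M := by
  -- sizes of `q`, `k`, `log q`, `log k`, `η`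
  have hq3 : (3 : ℝ) ≤ q := by exact_mod_cast hz.three_le
  have hq0 : (0 : ℝ) < q := by linarith
  have hL1 : 1 < Real.log q := by
    rw [Real.lt_log_iff_exp_lt hq0]
    linarith [Real.exp_one_lt_d9]
  have hL0 : 0 < Real.log q := by linarith
  have hη : 10 ≤ η := hz.ten_le
  have hηL : 0 < η * Real.log q := by positivity
  have hk1 : 1 ≤ k := NeZero.one_le
  have hkR1 : (1 : ℝ) ≤ k := by exact_mod_cast hk1
  have hkR0 : (0 : ℝ) < k := by linarith
  have hqkR : (q : ℝ) ≤ k := by exact_mod_cast hqk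
  have hkq2R : (k : ℝ) ≤ (q : ℝ) ^ 2 := by rw [sq]; exact_mod_cast hkq
  have hlogk : Real.log k ≤ 2 * Real.log q := by
    have := Real.log_le_log hkR0 hkq2R
    rwa [Real.log_pow, Nat.cast_ofNat] at this
  have hlogk0 : 0 ≤ Real.log k := Real.log_nonneg hkR1
  have hM1 : (1 : ℝ) ≤ M := le_trans (Real.one_le_exp (by positivity)) hM
  -- the induced character and the zero
  obtain ⟨hψ1, hψ2, hψL⟩ := bias_transfer hdvd hz
  set ψ := DirichletCharacter.changeLevel hdvd χ with hψdef
  set β : ℝ := 1 - 1 / (η * Real.log q) with hβdef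
  have h1β : 1 - β = 1 / (η * Real.log q) := by simp only [hβdef]; ring
  have hβ1 : β < 1 := by
    have := one_div_pos.2 hηL
    simp only [hβdef]
    linarith
  have hβ0 : 0 < β := by
    simp only [hβdef]
    have h10 : 1 < η * Real.log q := by
      have := mul_le_mul_of_nonneg_right hη hL0.le
      linarith
    have : 1 / (η * Real.log q) < 1 := (div_lt_one hηL).2 h10
    linarith
  -- the window `1 - c₁ / log (4k) < β`
  have hlog4k0 : 0 < Real.log (4 * k) := Real.log_pos (by linarith)
  have hq9 : (9 : ℝ) ≤ (q : ℝ) ^ 2 := by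
    rw [sq]
    exact le_trans (by norm_num) (mul_le_mul hq3 hq3 (by norm_num) hq0.le)
  have hlog4k : Real.log (4 * k) ≤ 4 * Real.log q := by
    have h4 : (4 : ℝ) * k ≤ (q : ℝ) ^ 4 :=
      calc (4 : ℝ) * k ≤ 4 * (q : ℝ) ^ 2 := by linarith
        _ ≤ (q : ℝ) ^ 2 * (q : ℝ) ^ 2 := mul_le_mul_of_nonneg_right (by linarith) (by positivity)
        _ = (q : ℝ) ^ 4 := by ring
    have := Real.log_le_log (by positivity) h4
    rwa [Real.log_pow, Nat.cast_ofNat] at this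
  have hwin : 1 - c₁ / Real.log (4 * k) < β := by
    simp only [hβdef]
    have : 1 / (η * Real.log q) < c₁ / Real.log (4 * k) := by
      rw [div_lt_div_iff₀ hηL hlog4k0]
      have := mul_lt_mul_of_pos_right hR4 hL0
      linarith
    linarith
  -- the law at level `k`
  obtain ⟨R, hR0le, hRlaw⟩ := hlaw k ψ hψ1 hψ2 β hwin hβ1 hψL
  have hden : 0 < C₂ * (1 + Real.log k) ^ 5 := by positivity
  have hRinv0 : 1 ≤ R * (C₂ * (1 + Real.log k) ^ 5) := by rwa [div_le_iff₀ hden] at hR0le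
  have hRpos : 0 < R := lt_of_lt_of_le (by positivity) hR0le
  have hRinv : 1 ≤ R * (C₂ * (1 + 2 * Real.log q) ^ 5) :=
    le_trans hRinv0 (mul_le_mul_of_nonneg_left (mul_le_mul_of_nonneg_left
      (pow_le_pow_left₀ (by linarith) (by linarith) 5) hC₂.le) hRpos.le)
  -- the two sample points
  have hEk : Real.exp (C₁ * (1 + Real.log k) ^ 2) ≤ M :=
    le_trans (Real.exp_le_exp.2 (mul_le_mul_of_nonneg_left
      (pow_le_pow_left₀ (by linarith) (by linarith) 2) hC₁.le)) hM
  have hM0 : (0 : ℝ) ≤ M := by linarith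
  have hMk : (M : ℝ) ≤ k * M := le_mul_of_one_le_left hM0 hkR1
  have hy₁E : Real.exp (C₁ * (1 + Real.log k) ^ 2) ≤ (k : ℝ) * M + 1 := by linarith
  have hy₂E : Real.exp (C₁ * (1 + Real.log k) ^ 2) ≤ 2 * (k : ℝ) * M + 1 := by linarith
  have h1 := hRlaw _ hy₁E
  have h2 := hRlaw _ hy₂E
  have hφ0 : (0 : ℝ) < (Nat.totient k : ℝ) := by exact_mod_cast Nat.totient_pos.2 hk1
  have hφk : (Nat.totient k : ℝ) ≤ k := by exact_mod_cast Nat.totient_le k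
  have hdiff := bias_diff_lower hRpos.le hβ0 hβ1.le hφ0 hφk hkR1 hM1 h1 h2
  -- undamping
  have hy₂pos : (0 : ℝ) < 2 * (k : ℝ) * M + 1 := by positivity
  have hD : Real.exp (-1) ≤ (2 * (k : ℝ) * M + 1) ^ (β - 1) := by
    refine bias_undamped hy₂pos ?_
    rw [h1β]
    have hlogy : Real.log (2 * (k : ℝ) * M + 1) ≤ η * Real.log q := by
      refine le_trans (Real.log_le_log hy₂pos ?_) hR5
      have := mul_le_mul_of_nonneg_right hkq2R hM0
      linarith
    rw [one_div_mul_eq_div, div_le_one hηL]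
    exact hlogy
  -- the size condition `50 (R + 1) ≤ R k²`
  have hRk : 50 * (R + 1) ≤ R * (k : ℝ) ^ 2 := by
    have hq2k2 : (q : ℝ) ^ 2 ≤ (k : ℝ) ^ 2 := pow_le_pow_left₀ hq0.le hqkR 2
    calc 50 * (R + 1) = 50 * R + 50 * 1 := by ring
      _ ≤ 50 * R + 50 * (R * (C₂ * (1 + 2 * Real.log q) ^ 5)) := by linarith
      _ = R * (50 * (1 + C₂ * (1 + 2 * Real.log q) ^ 5)) := by ring
      _ ≤ R * (q : ℝ) ^ 2 := mul_le_mul_of_nonneg_left hR6 hRpos.le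
      _ ≤ R * (k : ℝ) ^ 2 := mul_le_mul_of_nonneg_left hq2k2 hRpos.le
  have hquarter := bias_quarter hRpos.le hM0 hkR0 hD hRk
  -- assemble
  have hT := le_trans hquarter hdiff
  rw [bias_P_one_eq k M hk1]
  have hb0 : 0 < 4 * C₂ * (1 + 2 * Real.log q) ^ 5 := by positivity
  rw [div_le_iff₀ hb0]
  calc (M : ℝ) = 1 * M := by ring
    _ ≤ (R * (C₂ * (1 + 2 * Real.log q) ^ 5)) * M := mul_le_mul_of_nonneg_right hRinv hM0
    _ = (R * M / 4) * (4 * C₂ * (1 + 2 * Real.log q) ^ 5) := by ring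
    _ ≤ _ := mul_le_mul_of_nonneg_right hT hb0.le

end Summit.Parity.GeneralizedHardyLittlewood.Theorems.DilatedChowla.Negative

end
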